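import Mathlib
import Summits.AtomisticToContinuum.Crystallization.Theses.PhononSlackCertificates
import Summits.AtomisticToContinuum.Crystallization.Theorems.PhononSlackCertificatesNearFarGlueRStableCoreSteps
import Summits.AtomisticToContinuum.Crystallization.Theorems.PhononSlackCertificatesNearFarGlueRWellBonded
import Summits.AtomisticToContinuum.Crystallization.Theorems.PhononSlackCertificatesNearFarGlueRLooseReduction
import Summits.AtomisticToContinuum.Crystallization.Theorems.PhononSlackCertificatesNearFarGlueRLooseTarget
import Literature.MathematicalPhysics.StatisticalMechanics.LennardJonesClusters

/-!
# Crux `PhononSlackCertificates.NearFarGlueR` (stmt-AtomisticToContinuum-14970), line `Sketch`: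
STABLE-CORE exhaustion — every configuration reduces to a well-bonded, hole-free, move-stable core

Continuation lead c4, part 3e-ii (registered sub-goal `stub_stableCoreExhaustion`).  Three monotone
operations on a `3/10`-separated configuration each LOWER the excess `𝓔(x) − N·e*` by a fixed
quantum while changing the counts `#T` (tight contacts) and `#bad` by a bounded amount
(part 3e-i, `…NearFarGlueRStableCoreSteps`):

* `strip_step` — STRIP the loose particles (`A_j ≥ −θ`): quantum `0.711 − θ` per particle
  (certified `e* ≤ −0.711`), counts `5833` / `1332` per particle;
* `fill_step` — FILL a deep hole (`W_p ≤ −98309653/125000000 − g`, `p` at distance `≥ 3/10` from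
  everything): quantum `g` (certified two-cone floor `e* ≥ −0.7865`), counts `5833` / `1332`;
* `move_step` — MOVE one particle to a site at distance `≥ 3/10` from the others where it binds
  more strongly by `g'`: quantum `g'` (pure move principle, no bound on `e*`), counts `11664` /
  `2662`.

Since the excess is `≥ 0` (periodisation), at most `excess / min(0.711 − θ, g, g')` quanta are
available, so alternating the three operations terminates (`exists_stableCore_of_sep`, strong
induction on the energy budget) in a **stable core**: `3/10`-separated, `θ`-WELL-BONDED (bound at
least kink-like for `θ ≈ 0.71`), `g`-HOLE-FREE (no vacancy-type site) and `g'`-MOVE-STABLE (no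
particle gains `g'` by a single relocation — in particular no displaced "rattler" whose hop back to
its cage centre would gain `g'`: that site is too close to the particle to be a hole of `x`, but is
admissible for `x ∖ j`).  `exists_stableCore` runs c3's net-bound strip first (for separation):
every finite injective `x` has a stable core `z` with
`[𝓔(z) − K·e*] + min(0.711 − θ, g, g')·u ≤ 𝓔(x) − N·e*`, `#T(x) ≤ #T(z) + 11664·u`,
`#bad(x) ≤ #bad(z) + 2662·u`.  (Part 3b `…NearFarGlueRCore` is the two-operation version.)
All `[folklore]`.
-/

noncomputable section

namespace Summit.AtomisticToContinuum.Crystallization.Theorems.PhononSlackCertificatesNearFarGlueR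

open Literature.MathematicalPhysics.StatisticalMechanics
open Literature.Geometry.DiscreteGeometry
open Summit.AtomisticToContinuum.Crystallization.Theses.PhononSlackCertificates
open Summit.AtomisticToContinuum.Crystallization.Theorems.ChargedEnergyGapNegative
  (eStar card_mul_eStar_le)
open scoped BigOperators

/-! ## §1 Stable-core exhaustion (strong induction on the energy budget) -/

/-- **Stable-core exhaustion.**  Fix `θ < 0.711`, `g > 0`, `g' > 0`, `c := min(0.711 − θ, g, g')`.
Every `3/10`-separated `x` with excess `≤ c·M` reaches, by at most `M` quanta of strips, fills and
moves, a STABLE CORE `z`: `3/10`-separated, `θ`-well-bonded, `g`-hole-free, `g'`-move-stable, with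
`[𝓔(z) − K·e*] + c·u ≤ 𝓔(x) − N·e*`, `#T(x) ≤ #T(z) + 11664·u`, `#bad(x) ≤ #bad(z) + 2662·u`.
[folklore] -/
theorem exists_stableCore_of_sep {θ g g' : ℝ} (hθ : θ < 711 / 1000) (hg : 0 < g) (hg' : 0 < g') :
    ∀ (M N : ℕ) (x : Fin N → EuclideanSpace ℝ (Fin 3)),
      (∀ i j : Fin N, i ≠ j → (3 / 10 : ℝ) ≤ dist (x i) (x j)) →
      interactionEnergy lennardJones x -
          (N : ℝ) * (⨅ Q : PeriodicConfiguration 3, Q.energyPerParticle lennardJones) ≤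
        min (min (711 / 1000 - θ) g) g' * M →
      ∃ (K : ℕ) (z : Fin K → EuclideanSpace ℝ (Fin 3)) (u : ℕ),
        (∀ i j : Fin K, i ≠ j → (3 / 10 : ℝ) ≤ dist (z i) (z j)) ∧
        (∀ j : Fin K, ∑ k ∈ Finset.univ.erase j,
        (min (lennardJones (dist (z j) (z k))) 0 +
          (1 / 2 : ℝ) * max (lennardJones (dist (z j) (z k))) 0) < -θ) ∧
        (∀ p : EuclideanSpace ℝ (Fin 3), (∀ i : Fin K, (3 / 10 : ℝ) ≤ dist p (z i)) →
        -(98309653 / 125000000 : ℝ) - g < ∑ i, lennardJones (dist p (z i))) ∧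
        (∀ (j : Fin K) (p : EuclideanSpace ℝ (Fin 3)),
        (∀ k : Fin K, k ≠ j → (3 / 10 : ℝ) ≤ dist p (z k)) →
        ∑ k ∈ Finset.univ.erase j, lennardJones (dist (z j) (z k)) - g' <
          ∑ k ∈ Finset.univ.erase j, lennardJones (dist p (z k))) ∧
        interactionEnergy lennardJones z -
          (K : ℝ) * (⨅ Q : PeriodicConfiguration 3, Q.energyPerParticle lennardJones) +
            min (min (711 / 1000 - θ) g) g' * u ≤
          interactionEnergy lennardJones x -
          (N : ℝ) * (⨅ Q : PeriodicConfiguration 3, Q.energyPerParticle lennardJones) ∧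
        (Nat.card {j : Fin N // ¬ IsTwoShellGood (1 / 20) (47 / 50) 1 x j ∧
            ∃ i : Fin N, IsTwoShellGood (1 / 20) (47 / 50) 1 x i ∧ dist (x i) (x j) ≤ 21 / 20} : ℝ) ≤
          (Nat.card {j : Fin K // ¬ IsTwoShellGood (1 / 20) (47 / 50) 1 z j ∧
            ∃ i : Fin K, IsTwoShellGood (1 / 20) (47 / 50) 1 z i ∧ dist (z i) (z j) ≤ 21 / 20} : ℝ) +
            11664 * u ∧
        (Nat.card {j : Fin N // ¬ IsTwoShellGood (1 / 20) (47 / 50) 1 x j} : ℝ) ≤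
          (Nat.card {j : Fin K // ¬ IsTwoShellGood (1 / 20) (47 / 50) 1 z j} : ℝ) + 2662 * u := by
  set c : ℝ := min (min (711 / 1000 - θ) g) g' with hc
  have hc0 : 0 < c := lt_min (lt_min (by linarith) hg) hg'
  intro M
  induction M using Nat.strong_induction_on with
  | _ M ih =>
    intro N x hsep hE
    by_cases hcore : (∀ j : Fin N, ∑ k ∈ Finset.univ.erase j,
        (min (lennardJones (dist (x j) (x k))) 0 +
          (1 / 2 : ℝ) * max (lennardJones (dist (x j) (x k))) 0) < -θ) ∧
      (∀ p : EuclideanSpace ℝ (Fin 3), (∀ i : Fin N, (3 / 10 : ℝ) ≤ dist p (x i)) →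
        -(98309653 / 125000000 : ℝ) - g < ∑ i, lennardJones (dist p (x i))) ∧
      (∀ (j : Fin N) (p : EuclideanSpace ℝ (Fin 3)),
        (∀ k : Fin N, k ≠ j → (3 / 10 : ℝ) ≤ dist p (x k)) →
        ∑ k ∈ Finset.univ.erase j, lennardJones (dist (x j) (x k)) - g' <
          ∑ k ∈ Finset.univ.erase j, lennardJones (dist p (x k)))
    · exact ⟨N, x, 0, hsep, hcore.1, hcore.2.1, hcore.2.2, by simp, by simp, by simp⟩
    · obtain ⟨N', y, w, hw, hysep, hEy, hTy, hBy⟩ := stableCore_step x hsep hcore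
      have hyinj : Function.Injective y := fibre_injective_of_separated (by norm_num) hysep
      have hy0 : (N' : ℝ) * (⨅ Q : PeriodicConfiguration 3, Q.energyPerParticle lennardJones) ≤
          interactionEnergy lennardJones y := card_mul_eStar_le hyinj
      -- the budget pays for `w` quanta, so `w ≤ M`
      have hwM : w ≤ M := by
        by_contra hlt
        push Not at hlt
        have hlt' : (M : ℝ) + 1 ≤ w := by exact_mod_cast hlt
        nlinarith [hEy, hE, hy0, hc0, hlt']
      have hw1 : (1 : ℝ) ≤ w := by exact_mod_cast hw
      have hcast : ((M - w : ℕ) : ℝ) = (M : ℝ) - w := by rw [Nat.cast_sub hwM]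
      have hEy' : interactionEnergy lennardJones y -
          (N' : ℝ) * (⨅ Q : PeriodicConfiguration 3, Q.energyPerParticle lennardJones) ≤
          c * ((M - w : ℕ) : ℝ) := by
        rw [hcast]
        nlinarith [hEy, hE]
      obtain ⟨K, z, u, hzsep, hzwb, hzhf, hzms, hEz, hTz, hBz⟩ :=
        ih (M - w) (by omega) N' y hysep hEy'
      refine ⟨K, z, u + w, hzsep, hzwb, hzhf, hzms, ?_, ?_, ?_⟩
      · push_cast
        nlinarith [hEz, hEy]
      · push_cast
        linarith [hTy, hTz]
      · push_cast
        linarith [hBy, hBz]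

/-! ## §2 Every configuration has a stable core -/

/-- **Every finite injective configuration has a stable core** (`0 ≤ θ < 0.711`, `g, g' > 0`):
strip to the net-bound core first (c3's `exists_netBound_core`, for separation, at `0.711` per
stripped particle), then run the stable-core exhaustion. [folklore] -/
theorem exists_stableCore {θ g g' : ℝ} (hθ0 : 0 ≤ θ) (hθ : θ < 711 / 1000) (hg : 0 < g)
    (hg' : 0 < g') {N : ℕ} (x : Fin N → EuclideanSpace ℝ (Fin 3)) (hx : Function.Injective x) :
    ∃ (K : ℕ) (z : Fin K → EuclideanSpace ℝ (Fin 3)) (u : ℕ),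
        (∀ i j : Fin K, i ≠ j → (3 / 10 : ℝ) ≤ dist (z i) (z j)) ∧
        (∀ j : Fin K, ∑ k ∈ Finset.univ.erase j,
        (min (lennardJones (dist (z j) (z k))) 0 +
          (1 / 2 : ℝ) * max (lennardJones (dist (z j) (z k))) 0) < -θ) ∧
        (∀ p : EuclideanSpace ℝ (Fin 3), (∀ i : Fin K, (3 / 10 : ℝ) ≤ dist p (z i)) →
        -(98309653 / 125000000 : ℝ) - g < ∑ i, lennardJones (dist p (z i))) ∧
        (∀ (j : Fin K) (p : EuclideanSpace ℝ (Fin 3)),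
        (∀ k : Fin K, k ≠ j → (3 / 10 : ℝ) ≤ dist p (z k)) →
        ∑ k ∈ Finset.univ.erase j, lennardJones (dist (z j) (z k)) - g' <
          ∑ k ∈ Finset.univ.erase j, lennardJones (dist p (z k))) ∧
        interactionEnergy lennardJones z -
          (K : ℝ) * (⨅ Q : PeriodicConfiguration 3, Q.energyPerParticle lennardJones) +
            min (min (711 / 1000 - θ) g) g' * u ≤
          interactionEnergy lennardJones x -
          (N : ℝ) * (⨅ Q : PeriodicConfiguration 3, Q.energyPerParticle lennardJones) ∧
        (Nat.card {j : Fin N // ¬ IsTwoShellGood (1 / 20) (47 / 50) 1 x j ∧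
            ∃ i : Fin N, IsTwoShellGood (1 / 20) (47 / 50) 1 x i ∧ dist (x i) (x j) ≤ 21 / 20} : ℝ) ≤
          (Nat.card {j : Fin K // ¬ IsTwoShellGood (1 / 20) (47 / 50) 1 z j ∧
            ∃ i : Fin K, IsTwoShellGood (1 / 20) (47 / 50) 1 z i ∧ dist (z i) (z j) ≤ 21 / 20} : ℝ) +
            11664 * u ∧
        (Nat.card {j : Fin N // ¬ IsTwoShellGood (1 / 20) (47 / 50) 1 x j} : ℝ) ≤
          (Nat.card {j : Fin K // ¬ IsTwoShellGood (1 / 20) (47 / 50) 1 z j} : ℝ) + 2662 * u := by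
  classical
  set c : ℝ := min (min (711 / 1000 - θ) g) g' with hc
  have hc0 : 0 < c := lt_min (lt_min (by linarith) hg) hg'
  have hc1 : c ≤ 711 / 1000 := ((min_le_left _ _).trans (min_le_left _ _)).trans (by linarith)
  obtain ⟨K₁, f₁, hnet, hE₁⟩ := exists_netBound_core N x hx
  set y := x ∘ f₁ with hy
  have hyinj : Function.Injective y := hx.comp f₁.injective
  have hysep : ∀ k l : Fin K₁, k ≠ l → (3 / 10 : ℝ) ≤ dist (y k) (y l) := sep_of_netBound y hyinj hnet
  have hT₁ := card_contact_le_strip x f₁ hysep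
  have hB₁ := card_bad_le_strip x f₁ hysep
  have hKN : K₁ ≤ N := by simpa using Fintype.card_le_of_embedding f₁
  have hKNr : (0 : ℝ) ≤ (N : ℝ) - K₁ := by
    have : (K₁ : ℝ) ≤ N := by exact_mod_cast hKN
    linarith
  set exc : ℝ := interactionEnergy lennardJones y -
      (K₁ : ℝ) * (⨅ Q : PeriodicConfiguration 3, Q.energyPerParticle lennardJones) with hexc
  set M : ℕ := ⌈exc / c⌉₊ with hM
  have hbudget : exc ≤ c * M := by
    have h1 : exc / c ≤ M := Nat.le_ceil _
    rw [div_le_iff₀ hc0] at h1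
    linarith
  obtain ⟨K, z, u, hzsep, hzwb, hzhf, hzms, hEz, hTz, hBz⟩ :=
    exists_stableCore_of_sep hθ hg hg' M K₁ y hysep hbudget
  have hcast : ((u + (N - K₁) : ℕ) : ℝ) = (u : ℝ) + ((N : ℝ) - K₁) := by
    push_cast [Nat.cast_sub hKN]; ring
  refine ⟨K, z, u + (N - K₁), hzsep, hzwb, hzhf, hzms, ?_, ?_, ?_⟩
  · rw [hcast]
    have hcNK : c * ((N : ℝ) - K₁) ≤ (711 / 1000 : ℝ) * ((N : ℝ) - K₁) :=
      mul_le_mul_of_nonneg_right hc1 hKNr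
    have hEz' : interactionEnergy lennardJones z -
        (K : ℝ) * (⨅ Q : PeriodicConfiguration 3, Q.energyPerParticle lennardJones) + c * u ≤ exc := hEz
    nlinarith [hEz', hE₁, hcNK]
  · rw [hcast]
    have hT₁' : (Nat.card {j : Fin N // ¬ IsTwoShellGood (1 / 20) (47 / 50) 1 x j ∧
            ∃ i : Fin N, IsTwoShellGood (1 / 20) (47 / 50) 1 x i ∧ dist (x i) (x j) ≤ 21 / 20} : ℝ) ≤
        5833 * ((N : ℝ) - K₁) +
        (Nat.card {j : Fin K₁ // ¬ IsTwoShellGood (1 / 20) (47 / 50) 1 y j ∧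
            ∃ i : Fin K₁, IsTwoShellGood (1 / 20) (47 / 50) 1 y i ∧ dist (y i) (y j) ≤ 21 / 20} : ℝ) := by
      have := hT₁; simp only [hy] at this ⊢; linarith
    nlinarith [hT₁', hTz, hKNr]
  · rw [hcast]
    have hB₁' : (Nat.card {j : Fin N // ¬ IsTwoShellGood (1 / 20) (47 / 50) 1 x j} : ℝ) ≤
        1332 * ((N : ℝ) - K₁) + (Nat.card {j : Fin K₁ // ¬ IsTwoShellGood (1 / 20) (47 / 50) 1 y j} : ℝ) := by
      have := hB₁; simp only [hy] at this ⊢; linarith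
    nlinarith [hB₁', hBz, hKNr]

/-- **Registered sub-goal `stub_stableCoreExhaustion` of the crux item** (skeleton
`Lines/Sketch.lean`, c4): every finite injective configuration has a well-bonded, hole-free,
move-stable, `3/10`-separated core — the statement of `exists_stableCore` in closed form.
[folklore] -/
theorem stub_stableCoreExhaustion :
    ∀ (θ g g' : ℝ), 0 ≤ θ → θ < 711 / 1000 → 0 < g → 0 < g' →
    ∀ (N : ℕ) (x : Fin N → EuclideanSpace ℝ (Fin 3)), Function.Injective x →
    ∃ (K : ℕ) (z : Fin K → EuclideanSpace ℝ (Fin 3)) (u : ℕ),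
        (∀ i j : Fin K, i ≠ j → (3 / 10 : ℝ) ≤ dist (z i) (z j)) ∧
        (∀ j : Fin K, ∑ k ∈ Finset.univ.erase j,
        (min (lennardJones (dist (z j) (z k))) 0 +
          (1 / 2 : ℝ) * max (lennardJones (dist (z j) (z k))) 0) < -θ) ∧
        (∀ p : EuclideanSpace ℝ (Fin 3), (∀ i : Fin K, (3 / 10 : ℝ) ≤ dist p (z i)) →
        -(98309653 / 125000000 : ℝ) - g < ∑ i, lennardJones (dist p (z i))) ∧
        (∀ (j : Fin K) (p : EuclideanSpace ℝ (Fin 3)),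
        (∀ k : Fin K, k ≠ j → (3 / 10 : ℝ) ≤ dist p (z k)) →
        ∑ k ∈ Finset.univ.erase j, lennardJones (dist (z j) (z k)) - g' <
          ∑ k ∈ Finset.univ.erase j, lennardJones (dist p (z k))) ∧
        interactionEnergy lennardJones z -
          (K : ℝ) * (⨅ Q : PeriodicConfiguration 3, Q.energyPerParticle lennardJones) +
            min (min (711 / 1000 - θ) g) g' * u ≤
          interactionEnergy lennardJones x -
          (N : ℝ) * (⨅ Q : PeriodicConfiguration 3, Q.energyPerParticle lennardJones) ∧
        (Nat.card {j : Fin N // ¬ IsTwoShellGood (1 / 20) (47 / 50) 1 x j ∧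
            ∃ i : Fin N, IsTwoShellGood (1 / 20) (47 / 50) 1 x i ∧ dist (x i) (x j) ≤ 21 / 20} : ℝ) ≤
          (Nat.card {j : Fin K // ¬ IsTwoShellGood (1 / 20) (47 / 50) 1 z j ∧
            ∃ i : Fin K, IsTwoShellGood (1 / 20) (47 / 50) 1 z i ∧ dist (z i) (z j) ≤ 21 / 20} : ℝ) +
            11664 * u ∧
        (Nat.card {j : Fin N // ¬ IsTwoShellGood (1 / 20) (47 / 50) 1 x j} : ℝ) ≤
          (Nat.card {j : Fin K // ¬ IsTwoShellGood (1 / 20) (47 / 50) 1 z j} : ℝ) + 2662 * u :=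
  fun _ _ _ hθ0 hθ hg hg' _ x hx => exists_stableCore hθ0 hθ hg hg' x hx

end Summit.AtomisticToContinuum.Crystallization.Theorems.PhononSlackCertificatesNearFarGlueR

end
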